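import Literature.AnabelianGeometry.AbsoluteAnabelian.AbsTopIThm214GroupPartProofs
import Literature.AnabelianGeometry.AbsoluteAnabelian.AbsTopIRankFormulaProofs
import HarnessLib

/-!
# [AbsTopI] Theorem 2.14 (i), group-theoretic part — UNCONDITIONAL forms

S. Mochizuki, *Topics in Absolute Anabelian Geometry I: Generalities* [AbsTopI], Theorem 2.14 (i)
p. 33 (lit key `paper:url-11ac98ba15fc`; bib key `MochizukiAbsTopI2012`).  The file
`AbsTopIThm214GroupPartProofs` (abc-iut-L4-t6) proved the group-theoretic part of Thm 2.14 (i) —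
"`p₁ = p₂`", "`φ` induces isomorphisms `Δ₁ ⥲ Δ₂`, `G₁ ⥲ G₂`", equal minimal almost-pro sets,
packaged as `FundamentalExtension.Thm214GroupPart B₁ B₂ φ` — RELATIVE to the [AbsTopI] Thm 2.6 (ii)
rank formula in its named form `FundamentalExtension.thm26_ii_delta_gal` (hypothesis `hδ`), resp.
relative to [AbsAnab] Prop 1.2.1 (i) `galoisMLF_iso_residueChar_eq` (hypothesis `h121`).  Both
named facts are now THEOREMS of the tree (`thm26_ii_delta_gal_holds`, abc-iut-L4-t4/d1, from the
local class field theory trunk; `galoisMLF_iso_residueChar_eq_of_delta`).  This proof-only file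
(no definitions) removes those hypotheses: the residue characteristic, the group part of
Thm 2.14 (i) for `Δ`-preserving isomorphisms, for pairs satisfying the typed Thm 2.6 (v)
`ζ`-characterization (`Thm26v`), and for pairs whose `Δ` is the maximal topologically finitely
generated closed normal subgroup ([AbsTopII] Remark 3.3.2 regime, `GeomIsMaxTFGNormalIn ⊤`) hold
outright.  What remains an INPUT is only the regime hypothesis on the two extensions (`Thm26v`,
resp. `GeomIsMaxTFGNormalIn ⊤`), i.e. the typed content of [AbsTopI] Thm 2.6 (v)/(vi) for the
particular `Π`'s — not a named unproved fact.
-/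

namespace Literature.AnabelianGeometry.AbsoluteAnabelian

namespace FundamentalExtension

variable {E F : FundamentalExtension.{0}}

/-- "`p₁ = p₂`" of [AbsTopI] Thm 2.14 (i), UNCONDITIONAL: a `Δ`-preserving bicontinuous
`φ : Π₁ ⥲ Π₂` between extensions with MLF base data forces equal residue characteristics
([AbsAnab] Prop 1.2.1 (i), proved in the tree via the Thm 2.6 (ii) rank formula
`thm26_ii_delta_gal_holds`). [cite: MochizukiAbsTopI2012, Thm 2.14 (i) p.33] -/
theorem PreservesGeom.residueChar_eq (B₁ : E.MLFBase) (B₂ : F.MLFBase) {φ : E.arith ≃ₜ* F.arith}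
    (hφ : PreservesGeom φ) : B₁.p = B₂.p :=
  hφ.residueChar_eq_of_residueChar_fact
    (galoisMLF_iso_residueChar_eq_of_delta thm26_ii_delta_gal_holds) B₁ B₂

/-- [AbsTopI] Thm 2.14 (i), group part, UNCONDITIONAL for `Δ`-preserving isomorphisms: if
`φ(Δ₁) = Δ₂` then `p₁ = p₂`, `φ` induces `Δ₁ ⥲ Δ₂` and `G₁ ⥲ G₂`, and the minimal almost-pro sets
agree — `Thm214GroupPart B₁ B₂ φ` with no named-fact hypothesis.
[cite: MochizukiAbsTopI2012, Thm 2.14 (i) p.33] -/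
theorem PreservesGeom.thm214GroupPart (B₁ : E.MLFBase) (B₂ : F.MLFBase)
    {φ : E.arith ≃ₜ* F.arith} (hφ : PreservesGeom φ) : Thm214GroupPart B₁ B₂ φ :=
  thm214GroupPart_of_preservesGeom
    (galoisMLF_iso_residueChar_eq_of_delta thm26_ii_delta_gal_holds) B₁ B₂ hφ

/-- **[AbsTopI] Thm 2.14 (i), group-theoretic part — UNCONDITIONAL relative to the typed
Thm 2.6 (v)**: for extensions `Π₁`, `Π₂` with MLF base data each satisfying the typed
`ζ`-characterization of `Δ` (`Thm26v`), EVERY isomorphism of profinite groups `φ : Π₁ ⥲ Π₂`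
satisfies `Thm214GroupPart B₁ B₂ φ` ("`p₁ = p₂`", `φ(Δ₁) = Δ₂`, equal minimal almost-pro sets).
The rank-formula hypothesis `hδ` of `thm214GroupPart_of_thm26v_of_delta` is discharged by
`thm26_ii_delta_gal_holds`. [cite: MochizukiAbsTopI2012, Thm 2.14 (i) p.33] -/
theorem thm214GroupPart_of_thm26v {B₁ : E.MLFBase} {B₂ : F.MLFBase} (h₁ : E.Thm26v B₁)
    (h₂ : F.Thm26v B₂) (φ : E.arith ≃ₜ* F.arith) : Thm214GroupPart B₁ B₂ φ :=
  thm214GroupPart_of_thm26v_of_delta thm26_ii_delta_gal_holds h₁ h₂ φ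

/-- "`p₁ = p₂`" of Thm 2.14 (i) for an ARBITRARY isomorphism `φ : Π₁ ⥲ Π₂` between extensions
satisfying the typed Thm 2.6 (v), unconditional. [cite: MochizukiAbsTopI2012, Thm 2.14 (i) p.33] -/
theorem residueChar_eq_of_thm26v {B₁ : E.MLFBase} {B₂ : F.MLFBase} (h₁ : E.Thm26v B₁)
    (h₂ : F.Thm26v B₂) (φ : E.arith ≃ₜ* F.arith) : B₁.p = B₂.p :=
  (thm214GroupPart_of_thm26v h₁ h₂ φ).1

/-- [AbsTopI] Thm 2.14 (i), group part, in the [AbsTopII] Remark 3.3.2 regime, UNCONDITIONAL: if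
in both extensions `Δ` is the maximal topologically finitely generated closed normal subgroup of
`Π` (`GeomIsMaxTFGNormalIn ⊤`, the typed content of [AbsTopI] Thm 2.6 (v)/(vi) used by
[AbsTopII] Rmk 3.3.2), then every isomorphism `φ : Π₁ ⥲ Π₂` satisfies `Thm214GroupPart B₁ B₂ φ`.
[cite: MochizukiAbsTopI2012, Thm 2.14 (i) p.33] -/
theorem thm214GroupPart_of_geomIsMaxTFGNormalIn (B₁ : E.MLFBase) (B₂ : F.MLFBase)
    (hE : E.GeomIsMaxTFGNormalIn ⊤) (hF : F.GeomIsMaxTFGNormalIn ⊤) (φ : E.arith ≃ₜ* F.arith) :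
    Thm214GroupPart B₁ B₂ φ :=
  (preservesGeom_of_geomIsMaxTFGNormalIn hE hF φ).thm214GroupPart B₁ B₂

end FundamentalExtension

end Literature.AnabelianGeometry.AbsoluteAnabelian
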